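import Summits.HodgeConjecture.HodgeConjecture.Theses.CyclicUnitaryPowers

/-!
# Route CyclicUnitaryPowers — `Assembly` (assembly item stmt-HodgeConjecture-19548)

The assembly item of route `CyclicUnitaryPowers`,

  VeryGeneralDeckCommutatorsInHg → PowersHodgeOfDeckCommutators → DetSupportsBalanced → SectorComplement →
    _root_.HodgeConjecture,

is the route's deciding theorem `CyclicUnitaryPowers.closes` curried (its hypotheses are exactly the route
items named in the item, in the same order).  Pure logic over the route file; no other import, no
named-fact hypothesis, no sorry.  Honest framing: this is the declared-sector IMPLICATION only — K1
`VeryGeneralDeckCommutatorsInHg` (stmt-HodgeConjecture-19544) is open and `SectorComplement` is the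
declared residual; nothing here asserts the Hodge conjecture or the rung leaf.
-/

-- `Summit.HodgeConjecture.HodgeConjecture.Theorems` is the mandated namespace (single-problem
-- summit: Problem = Summit), which `linter.dupNamespace` flags on every declaration; the lakefile
-- turns the linter off tree-wide (weak option), restated here so stand-alone elaboration is
-- warning-free too.
set_option linter.dupNamespace false

namespace Summit.HodgeConjecture.HodgeConjecture.Theorems

/-- **Item stmt-HodgeConjecture-19548 (`Assembly`), route `CyclicUnitaryPowers`**: the route's items
(K1 deck commutators in the Hodge group for very general `p`-cyclic surfaces, K2 Hodge conjecture on all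
powers given those commutators and balanced determinant supports, S the balancing, and the declared
sector complement) imply the Hodge conjecture — literally the deciding theorem
`CyclicUnitaryPowers.closes`, curried.  The type is the route decl
`Summit.HodgeConjecture.HodgeConjecture.Theses.CyclicUnitaryPowers.Assembly`.
[cite: CarlsonToledo1999] -/
theorem cyclicUnitaryPowers_assembly_proof :
    Summit.HodgeConjecture.HodgeConjecture.Theses.CyclicUnitaryPowers.Assembly :=
  fun h₁ h₂ h₃ h₄ ↦
    Summit.HodgeConjecture.HodgeConjecture.Theses.CyclicUnitaryPowers.closes h₁ h₂ h₃ h₄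

end Summit.HodgeConjecture.HodgeConjecture.Theorems
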